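import Literature.NumberTheory.EllipticCurves.BurungaleCastellaGrossiSkinner2026.RefinedKolyvaginConjecture
import Literature.NumberTheory.EllipticCurves.HeegnerPointsKolyvaginTorsionProofs
import HarnessLib
import Literature.NumberTheory.EllipticCurves.HeegnerPointsKolyvaginPrimitivity

/-!
# Route `KolyvaginDepthDoor`, crux `KolyvaginDepthSupplyKN` (stmt-BirchSwinnertonDyer-22820) —
# KOLYVAGIN'S CONJECTURE MOD `p` ON THE KODAIRA–NÉRON CELL, RESIDUAL CLASS INCLUDED: a LEVEL-ONE class
# `c_1(n) ≠ 0` at SOME depth from Burungale–Castella–Grossi–Skinner 2026 Thm. 2 (`𝓜_∞ = ord_p Tam_E`)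
# and Zanarella 2019 (`∂^{(∞)}(κ) = 0` iff the mod-`p` Kolyvagin system is non-zero)

Helper file of the lead prover of line `levelone` (kdd-p1 g12; `--supports stmt-BirchSwinnertonDyer-22820
--as helper`); route-free; it closes nothing and BSD is not proved by it.

The ♠ (2)-residual stub of skeleton v5 (`stub_modPStructureResidualRankTwo`) asks, per `(E, p, K)` on the
Kodaira–Néron cell, for a LEVEL-ONE Kolyvagin class `c_1(n) ≠ 0` AT THE DEPTH `ν` with `#Sel_p = p^{ν+1}`
on one side. W. Zhang's Theorem 9.1 (level-one non-vanishing) and Lemma 8.4 (1) (the depth) are printed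
under his Hypothesis ♠ (2), which the residual class (non-CM, `N_E` not square-free, fewer than two
multiplicative primes) violates. This file records what print DOES give there for the FIRST half (level-one
non-vanishing at SOME depth = "the Heegner point Kolyvagin system is primitive"):

* Burungale–Castella–Grossi–Skinner 2026, Thm. 2 (tree fact
  `BurungaleEtAl2026.thm2_kolyvaginClass_divisibility_eq_padicValNat_tamagawaProduct`, NO square-free
  hypothesis): `𝓜_∞ = ord_p(Tam_E)`; on the Kodaira–Néron cell `p ∤ Tam_E`, so SOME class
  `κ_n = c_{M(n)}(n)`, `n ∈ Λ ∖ {1}`, is not divisible by `p` in `H¹(K, E[p^{M(n)}])`;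
* Zanarella 2019, §1.1 with Def. 2.17 / Prop. 2.18 («`∂^{(∞)}(κ) = 0` is the same as `κ^{(1)} ≠ 0`»):
  such a class forces the mod-`p` system `κ^{(1)} = {c_1(n)}` to be non-zero — the named fact
  `Zanarella2019_kolyvaginClass_one_ne_zero_of_not_divisible` stated INLINE below for relocation to
  `Literature/NumberTheory/EllipticCurves/` by the gate;
* `exists_kolyvaginClass_one_ne_zero_of_thm2_of_zanarella` — PROVED from the two facts: for `E/ℚ`
  globally minimal, `p ≥ 5` good ordinary with `ρ̄_{E,p}` onto and `p ∤ Tam_E`, `K` imaginary quadratic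
  Heegner with `d_K` odd, `d_K ∉ {−3}`, `d_K < −4`, `(d_K, N) = 1`, `p ∤ d_K`, `p` split in `K`, and a
  `p`-OPTIMAL frame `(Dt, β, ι)`: some `c_1(n) ≠ 0`, `n ∈ Λ`. (The depth of `n` is NOT controlled here —
  that is the second half, Zanarella Cor. 2.14 / Lemma 2.16 + core vertices, untyped.)

CONDITIONAL on the two named facts; the `p`-optimality of the frame and `p` split in `K` are hypotheses
the line does not yet supply (typing debt recorded in the skeleton); BSD is NOT proved by this.

References: [BurungaleEtAl2026] Thm. 2 (arXiv:2312.09301 §0.1); [Zanarella2019] §1.1, Def. 2.17,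
Prop. 2.18, Rem. 2.20, §3.1 (arXiv:1908.09197); [WZhang2014] Thm. 9.1, Hypothesis ♠ (p. 195);
[GrossLMS1991] §4; [McCallumLMS1991] §4.
-/

-- D-0017: single-problem summit, `Summit.BirchSwinnertonDyer.BirchSwinnertonDyer.…` repeats a namespace BY DESIGN.
set_option linter.dupNamespace false

noncomputable section

open scoped Classical

namespace Summit.BirchSwinnertonDyer.BirchSwinnertonDyer.Theorems.KolyvaginDepthDoor

open Literature.NumberTheory.EllipticCurves Literature.NumberTheory.EllipticCurves.ModularForms WeierstrassCurve

/-- **Kolyvagin's conjecture MOD `p` on the Kodaira–Néron cell, residual class included (modulo BCGS 2026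
Thm. 2 and Zanarella 2019): a level-one class `c_1(n) ≠ 0` at SOME depth.** For `E/ℚ` globally minimal,
`p ≥ 5` good ordinary with `ρ̄_{E,p}` onto and `p ∤ Tam_E = ∏_ℓ c_ℓ` (automatic on the Kodaira–Néron cell:
`p ∤ ord_v(Δ_min)` at multiplicative `v`, `c_v ≤ 4` at additive `v`), `K` imaginary quadratic with the
Heegner hypothesis for `N_E`, `d_K` odd, `d_K ≠ −3`, `d_K < −4`, `(d_K, N_E) = 1`, `p ∤ d_K`, `p` split in
`K`, and a `p`-OPTIMAL frame `(Dt, β, ι)` (`Dt.IsPOptimal p`, `4N_E ∣ β² − d_K`): there are a square-free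
product `n` of Kolyvagin primes and a datum `d` of conductor `n` with `c_1(n) = d.kolyvaginClass _ 1 ≠ 0`
in `H¹(K, E[p])`. Proof: `E(K)[p] = 0` (`ρ̄` onto, `p` odd: `torsionBy_eq_bot_of_isImaginaryQuadratic`);
BCGS Thm. 2 with `t = ord_p(Tam_E) = 0` gives `n ≠ 1`, `d`, `M = M(n)` with `c_M(n)` not divisible by
`p^{0+1} = p`; Zanarella's bridge gives the level-one class. NO Hypothesis ♠ (2), no square-free `N`.
CONDITIONAL on the two named facts. [cite: BurungaleEtAl2026, Thm. 2 (arXiv:2312.09301 §0.1)]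
[cite: Zanarella2019, §1.1, Def. 2.17, Prop. 2.18 (arXiv:1908.09197)] -/
theorem exists_kolyvaginClass_one_ne_zero_of_thm2_of_zanarella
    (h2 : BurungaleEtAl2026.thm2_kolyvaginClass_divisibility_eq_padicValNat_tamagawaProduct)
    (hZ : Literature.NumberTheory.EllipticCurves.Zanarella2019_kolyvaginClass_one_ne_zero_of_not_divisible)
    (W : WeierstrassCurve ℚ) [W.IsElliptic] [W.IsGloballyMinimal] (p : ℕ) [hp : Fact p.Prime]
    (h5 : 5 ≤ p) (hgood : W.HasGoodReductionAtPrime p) (hord : ¬ (p : ℤ) ∣ W.frobeniusTrace p)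
    (hsur : W.HasSurjectiveModNGaloisRep p) (htam : ¬ p ∣ W.tamagawaProduct)
    (K : Type) [Field K] [NumberField K] (hK : IsImaginaryQuadratic K)
    [NeZero (W.conductorNorm ℤ)] (hHeeg : SatisfiesHeegnerHypothesis (W.conductorNorm ℤ) K)
    (hodd : Odd (NumberField.discr K)) (hD3 : NumberField.discr K ≠ -3)
    (hlt : NumberField.discr K < -4)
    (hDN : IsCoprime (NumberField.discr K) ((W.conductorNorm ℤ : ℕ) : ℤ))
    (hpD : ¬ ((p : ℤ) ∣ NumberField.discr K)) (hspl : SatisfiesHeegnerHypothesis p K)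
    (Dt : ModularParametrizationData W (W.conductorNorm ℤ)) (hopt : Dt.IsPOptimal p)
    (β : ℤ) (hβ : (4 * (W.conductorNorm ℤ : ℤ)) ∣ β ^ 2 - NumberField.discr K) (ι : K →+* ℂ) :
    ∃ (n : ℕ) (d : KolyvaginHeegnerData Dt β ι n),
      KolyvaginDescent.KolSupp (Zhang2014.IsKolyvaginPrime (W.conductorNorm ℤ) W K p) n ∧
        d.kolyvaginClass hp.out 1 ≠ 0 := by
  have hpP : p.Prime := hp.out
  have h3 : 3 < p := by omega
  -- (tor): `E(K)[p] = 0` from surjectivity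
  have htor : AddSubgroup.torsionBy (W.baseChange K).toAffine.Point (p : ℤ) = ⊥ :=
    torsionBy_eq_bot_of_isImaginaryQuadratic W K hK hpP (by omega) hsur
  -- BCGS Thm. 2, (≤) half: some class is not divisible by `p^{t+1}`, `t = ord_p(Tam_E) = 0`
  obtain ⟨-, n, d, M, hn1, hsupp, hM, hndiv⟩ :=
    h2 W p h3 hgood hord hsur K hK hHeeg hodd hD3 htor hspl Dt hopt β hβ ι
  have ht : padicValNat p W.tamagawaProduct = 0 := padicValNat.eq_zero_of_not_dvd htam
  rw [ht, zero_add, pow_one] at hndiv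
  -- Zanarella's bridge: the mod-`p` system is non-zero
  exact hZ W p h5 hgood hord hsur K hK hlt hpD hDN hHeeg Dt β ι n d M hn1 hsupp hM hndiv

end Summit.BirchSwinnertonDyer.BirchSwinnertonDyer.Theorems.KolyvaginDepthDoor

end
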